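import Mathlib.MeasureTheory.Measure.Lebesgue.EqHaar
import Mathlib.MeasureTheory.Integral.Prod
import Mathlib.Analysis.SpecialFunctions.Pow.Integral
import Mathlib.Analysis.SpecialFunctions.JapaneseBracket
import Mathlib.Analysis.MeanInequalitiesPow
import Mathlib.Analysis.Normed.MulAction
import HarnessLib

/-!
# Multiplication by a bounded Lipschitz cut-off in the Gagliardo seminorm
# (Di Nezza–Palatucci–Valdinoci 2012, §5, Lemma 5.3 and the proof of Lemma 5.1)

Topic `Analysis/FunctionSpaces`. Theorems only: no definitions, no named facts, no `sorry`.

Di Nezza–Palatucci–Valdinoci, *Hitchhiker's guide to the fractional Sobolev spaces*, Bull. Sci. Math.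
136 (2012), **Lemma 5.3**: for `Ω ⊂ ℝⁿ` open, `0 < s < 1`, `1 ≤ p`, `u ∈ W^{s,p}(Ω)` and `ψ ∈ C^{0,1}(Ω)`
with `0 ≤ ψ ≤ 1`, `ψ u ∈ W^{s,p}(Ω)` and `‖ψ u‖_{W^{s,p}(Ω)} ≤ C ‖u‖_{W^{s,p}(Ω)}`.  The printed proof is two
estimates, which we formalise on the whole space (`Ω = E`, a real normed space with a measure `μ`),
for `F`-valued `u` and a real cut-off `ψ`, in the lower-integral / `ℝ≥0∞` form used by the Gagliardo
energies of `FractionalGagliardoSobolevInequality.lean`: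

* `lintegral_gagliardo_smul_le` — the algebraic step "adding and subtracting `ψ(x)u(y)`":
  `∬ ‖ψ(x)u(x) − ψ(y)u(y)‖^p / ‖x−y‖^N ≤ 2^{p−1} ( ∬ |ψ(x)|^p ‖u(x) − u(y)‖^p / ‖x−y‖^N`
  `+ ∫ ‖u(y)‖^p W(y) dy )` with the CUT-OFF WEIGHT `W(y) = ∫ |ψ(x) − ψ(y)|^p / ‖x−y‖^N dx`
  (any exponent `N`, any s-finite measure on a second-countable `E`; Tonelli for the second term);
* `exists_lintegral_lipschitzWeight_le` — the bound `W(y) ≤ C̃` uniformly in `y` for a bounded Lipschitz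
  `ψ` on a finite-dimensional `E` with an additive Haar measure and `N = n + sp` (the kernel
  `‖x−y‖^{−n+(1−s)p}` is summable near the diagonal and `‖x−y‖^{−n−sp}` away from it — here from Mathlib's
  `integrableOn_ball_of_norm_le_rpow` and `finite_integral_one_add_norm`);
* `lintegral_cutoffWeight_le_of_support` — the companion far-field bound from the proof of **Lemma 5.1**
  (`|u(x)|^p / |x−y|^{n+sp} ≤ χ_K(x)|u(x)|^p sup_{x ∈ K} |x−y|^{−n−sp}` for `y ∉ K`): if `ψ` vanishes off the
  closed ball `B̄(0,ρ₀)` and `|ψ| ≤ M`, then for `‖y‖ ≥ 2ρ₀`,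
  `W(y) ≤ M^p μ(B̄(0,ρ₀)) (‖y‖/2)^{−N}`.

Together with Theorem 6.5 (`FractionalGagliardoSobolevInequality.lean`) these give the localisation
"windowed Gagliardo energy of `u` on `B₂` + weighted `L^p` tail of `u` ⇒ `L^{p⋆}` bound for `ψu`,
hence for `u` on `{ψ = 1}`", which is how the compactly supported hypothesis of Theorem 6.5 is met for
fields that only decay at infinity.  What is NOT here: the `L^p(Ω)` packaging of Lemma 5.3 (our `u` need
not be in `L^p`; the weight form keeps the tail information), Lemma 5.2 (reflection), Theorem 5.4
(extension domains).
-/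

open MeasureTheory Metric Set Filter
open scoped ENNReal NNReal Topology

namespace Literature.Analysis.FunctionSpaces

namespace DiNezzaPalatucciValdinoci2012

/-! ### The algebraic step of Lemma 5.3 -/

section Algebra

variable {E : Type*} [NormedAddCommGroup E] [SecondCountableTopology E] [MeasurableSpace E]
  [BorelSpace E] {μ : Measure E} [SFinite μ] {F : Type*} [NormedAddCommGroup F] [NormedSpace ℝ F]

omit [SecondCountableTopology E] [MeasurableSpace E] [BorelSpace E] [SFinite μ] in
/-- `ψ(x)u(x) − ψ(y)u(y) = ψ(x)(u(x) − u(y)) + (ψ(x) − ψ(y))u(y)`, in norm. [folklore] -/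
private theorem enorm_smul_sub_smul_le (a b : ℝ) (u v : F) :
    ‖a • u - b • v‖ₑ ≤ ‖a‖ₑ * ‖u - v‖ₑ + ‖a - b‖ₑ * ‖v‖ₑ := by
  have h : a • u - b • v = a • (u - v) + (a - b) • v := by
    rw [smul_sub, sub_smul]; abel
  rw [h, ← enorm_smul, ← enorm_smul]
  exact enorm_add_le _ _

/-- **Lemma 5.3 of Di Nezza–Palatucci–Valdinoci, the algebraic step, weight form** (`Ω` = the whole
space, any exponent `N`, `1 ≤ p`): for a real cut-off `ψ` and an `F`-valued `u`,
`∬ ‖ψ x • u x − ψ y • u y‖^p / ‖x−y‖^N ≤ 2^{p−1} ( ∬ ‖ψ x‖^p ‖u x − u y‖^p / ‖x−y‖^N`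
`+ ∫ ‖u y‖^p (∫ ‖ψ x − ψ y‖^p / ‖x−y‖^N dx) dy )` — "adding and subtracting `ψ(x)u(y)`" and
`(a+b)^p ≤ 2^{p−1}(a^p + b^p)`, then Tonelli in the second term.
[cite: DinezzaPalatucciValdinoci2012, Lemma 5.3 proof] -/
theorem lintegral_gagliardo_smul_le (N : ℝ) {p : ℝ} (hp : 1 ≤ p) {ψ : E → ℝ} {u : E → F}
    (hψ : AEMeasurable ψ μ) (hu : AEStronglyMeasurable u μ) :
    ∫⁻ x, ∫⁻ y, ‖ψ x • u x - ψ y • u y‖ₑ ^ p / ‖x - y‖ₑ ^ N ∂μ ∂μ ≤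
      (2 : ℝ≥0∞) ^ (p - 1) *
        ((∫⁻ x, ∫⁻ y, ‖ψ x‖ₑ ^ p * (‖u x - u y‖ₑ ^ p / ‖x - y‖ₑ ^ N) ∂μ ∂μ) +
          ∫⁻ y, ‖u y‖ₑ ^ p * ∫⁻ x, ‖ψ x - ψ y‖ₑ ^ p / ‖x - y‖ₑ ^ N ∂μ ∂μ) := by
  have hp0 : 0 ≤ p := by linarith
  have h2top : (2 : ℝ≥0∞) ^ (p - 1) ≠ ⊤ := by simp [ENNReal.rpow_eq_top_iff]
  -- the two pieces
  set A : E → E → ℝ≥0∞ := fun x y => ‖ψ x‖ₑ ^ p * (‖u x - u y‖ₑ ^ p / ‖x - y‖ₑ ^ N) with hA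
  set B : E → E → ℝ≥0∞ := fun x y => ‖u y‖ₑ ^ p * (‖ψ x - ψ y‖ₑ ^ p / ‖x - y‖ₑ ^ N) with hB
  -- pointwise
  have hpt : ∀ x y, ‖ψ x • u x - ψ y • u y‖ₑ ^ p / ‖x - y‖ₑ ^ N ≤
      (2 : ℝ≥0∞) ^ (p - 1) * (A x y + B x y) := by
    intro x y
    simp only [hA, hB, div_eq_mul_inv]
    calc ‖ψ x • u x - ψ y • u y‖ₑ ^ p * (‖x - y‖ₑ ^ N)⁻¹
        ≤ (‖ψ x‖ₑ * ‖u x - u y‖ₑ + ‖ψ x - ψ y‖ₑ * ‖u y‖ₑ) ^ p * (‖x - y‖ₑ ^ N)⁻¹ :=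
          mul_le_mul_left (ENNReal.rpow_le_rpow (enorm_smul_sub_smul_le _ _ _ _) hp0) _
      _ ≤ (2 : ℝ≥0∞) ^ (p - 1) * ((‖ψ x‖ₑ * ‖u x - u y‖ₑ) ^ p + (‖ψ x - ψ y‖ₑ * ‖u y‖ₑ) ^ p) *
            (‖x - y‖ₑ ^ N)⁻¹ :=
          mul_le_mul_left (ENNReal.rpow_add_le_mul_rpow_add_rpow _ _ hp) _
      _ = _ := by
          rw [ENNReal.mul_rpow_of_nonneg _ _ hp0, ENNReal.mul_rpow_of_nonneg _ _ hp0]; ring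
  -- measurability on the product
  have hK : Measurable fun q : E × E => (‖q.1 - q.2‖ₑ ^ N)⁻¹ :=
    (ENNReal.continuous_rpow_const.comp (continuous_fst.sub continuous_snd).enorm).measurable.inv
  have hAm : AEMeasurable (fun q : E × E => A q.1 q.2) (μ.prod μ) := by
    simp only [hA, div_eq_mul_inv]
    exact (hψ.comp_fst.enorm.pow_const p).mul
      (((hu.comp_fst.sub hu.comp_snd).enorm.pow_const p).mul hK.aemeasurable)
  have hBm : AEMeasurable (Function.uncurry B) (μ.prod μ) := by
    simp only [hB, Function.uncurry_def, div_eq_mul_inv]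
    exact (hu.comp_snd.enorm.pow_const p).mul
      (((hψ.comp_fst.sub hψ.comp_snd).enorm.pow_const p).mul hK.aemeasurable)
  have hAx : ∀ x, AEMeasurable (fun y => A x y) μ := by
    intro x
    simp only [hA, div_eq_mul_inv]
    have hKx : Measurable fun y : E => (‖x - y‖ₑ ^ N)⁻¹ :=
      (ENNReal.continuous_rpow_const.comp (continuous_const.sub continuous_id).enorm).measurable.inv
    exact (((aestronglyMeasurable_const.sub hu).enorm.pow_const p).mul hKx.aemeasurable).const_mul _
  -- integrate
  calc ∫⁻ x, ∫⁻ y, ‖ψ x • u x - ψ y • u y‖ₑ ^ p / ‖x - y‖ₑ ^ N ∂μ ∂μ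
      ≤ ∫⁻ x, ∫⁻ y, (2 : ℝ≥0∞) ^ (p - 1) * (A x y + B x y) ∂μ ∂μ :=
        lintegral_mono fun x => lintegral_mono fun y => hpt x y
    _ = ∫⁻ x, (2 : ℝ≥0∞) ^ (p - 1) * ((∫⁻ y, A x y ∂μ) + ∫⁻ y, B x y ∂μ) ∂μ := by
        refine lintegral_congr fun x => ?_
        rw [lintegral_const_mul' _ _ h2top, lintegral_add_left' (hAx x)]
    _ = (2 : ℝ≥0∞) ^ (p - 1) * ((∫⁻ x, ∫⁻ y, A x y ∂μ ∂μ) + ∫⁻ x, ∫⁻ y, B x y ∂μ ∂μ) := by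
        rw [lintegral_const_mul' _ _ h2top, lintegral_add_left' hAm.lintegral_prod_right']
    _ = (2 : ℝ≥0∞) ^ (p - 1) * ((∫⁻ x, ∫⁻ y, A x y ∂μ ∂μ) + ∫⁻ y, ∫⁻ x, B x y ∂μ ∂μ) := by
        rw [lintegral_lintegral_swap (f := B) hBm]
    _ = _ := by
        congr 2
        refine lintegral_congr fun y => ?_
        simp only [hB]
        rw [lintegral_const_mul' _ _ (ENNReal.rpow_ne_top_of_nonneg hp0 enorm_ne_top)]

end Algebra

/-! ### The cut-off weight is bounded (Lemma 5.3) and decays off the support (Lemma 5.1) -/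

section Weight

variable {E : Type*} [NormedAddCommGroup E] [MeasurableSpace E]

/-- **Far-field bound of the cut-off weight** (the estimate of the proof of Lemma 5.1 of
Di Nezza–Palatucci–Valdinoci: for `y ∉ K ⊇ supp`, `|u(x)|^p/|x−y|^{n+sp} ≤ χ_K(x)|u(x)|^p sup_K |·−y|^{−n−sp}`):
if `|ψ| ≤ M` and `ψ = 0` off the closed ball `B̄(0,ρ₀)`, then for `‖y‖ ≥ 2ρ₀` and any `p > 0`, `N ≥ 0`,
`∫ ‖ψ x − ψ y‖^p / ‖x−y‖^N dμ(x) ≤ M^p (‖y‖/2)^{−N} μ(B̄(0,ρ₀))`.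
[cite: DinezzaPalatucciValdinoci2012, Lemma 5.1 proof] -/
theorem lintegral_cutoffWeight_le_of_support [OpensMeasurableSpace E] (μ : Measure E) {ψ : E → ℝ}
    {M ρ₀ : ℝ} (hρ₀ : 0 < ρ₀) (hM : ∀ x, |ψ x| ≤ M) (hsupp : ∀ x, ρ₀ < ‖x‖ → ψ x = 0)
    {p : ℝ} (hp : 0 < p) {N : ℝ} (hN : 0 ≤ N) {y : E} (hy : 2 * ρ₀ ≤ ‖y‖) :
    ∫⁻ x, ‖ψ x - ψ y‖ₑ ^ p / ‖x - y‖ₑ ^ N ∂μ ≤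
      ENNReal.ofReal (M ^ p) * (ENNReal.ofReal (‖y‖ / 2) ^ N)⁻¹ * μ (closedBall 0 ρ₀) := by
  have hM0 : 0 ≤ M := (abs_nonneg _).trans (hM 0)
  have hψy : ψ y = 0 := hsupp y (by linarith)
  have hsub : (Function.support fun x => ‖ψ x - ψ y‖ₑ ^ p / ‖x - y‖ₑ ^ N) ⊆ closedBall 0 ρ₀ := by
    intro x hx
    rw [mem_closedBall_zero_iff]
    by_contra h
    rw [not_le] at h
    apply hx
    simp [hψy, hsupp x h, ENNReal.zero_rpow_of_pos hp]
  rw [← setLIntegral_eq_of_support_subset hsub]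
  calc ∫⁻ x in closedBall 0 ρ₀, ‖ψ x - ψ y‖ₑ ^ p / ‖x - y‖ₑ ^ N ∂μ
      ≤ ∫⁻ x in closedBall 0 ρ₀, ENNReal.ofReal (M ^ p) * (ENNReal.ofReal (‖y‖ / 2) ^ N)⁻¹ ∂μ := by
        refine setLIntegral_mono' measurableSet_closedBall fun x hx => ?_
        rw [mem_closedBall_zero_iff] at hx
        rw [div_eq_mul_inv]
        refine mul_le_mul' ?_ ?_
        · rw [hψy, sub_zero, Real.enorm_eq_ofReal_abs, ENNReal.ofReal_rpow_of_nonneg (abs_nonneg _) hp.le]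
          exact ENNReal.ofReal_le_ofReal (Real.rpow_le_rpow (abs_nonneg _) (hM x) hp.le)
        · refine ENNReal.inv_le_inv.2 (ENNReal.rpow_le_rpow ?_ hN)
          rw [← ofReal_norm]
          refine ENNReal.ofReal_le_ofReal ?_
          have h1 : ‖y‖ - ‖x‖ ≤ ‖x - y‖ := by
            rw [norm_sub_rev]; exact norm_sub_norm_le y x
          linarith
    _ = _ := setLIntegral_const _ _

variable [NormedSpace ℝ E] [FiniteDimensional ℝ E] [BorelSpace E] (μ : Measure E) [μ.IsAddHaarMeasure]

/-- **Lemma 5.3 of Di Nezza–Palatucci–Valdinoci, the analytic step: the Lipschitz cut-off weight is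
bounded.**  For `0 < s < 1`, `1 ≤ p`, `n = dim E ≥ 1` and a bounded Lipschitz `ψ` (`|ψ| ≤ M`, constant `L`)
there is `C̃ < ∞` with `∫ ‖ψ x − ψ y‖^p / ‖x − y‖^{n+sp} dμ(x) ≤ C̃` for EVERY `y` — "the kernel
`|x−y|^{−n+(1−s)p}` is summable when `|x−y| ≤ 1` since `n + (s−1)p < n`, and `|x−y|^{−n−sp}` is summable when
`|x−y| ≥ 1` since `n + sp > n`" (printed with `0 ≤ ψ ≤ 1`; `C̃` depends on `μ, n, s, p, L, M`).
[cite: DinezzaPalatucciValdinoci2012, Lemma 5.3 proof] -/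
theorem exists_lintegral_lipschitzWeight_le (hn : 1 ≤ Module.finrank ℝ E) {s p : ℝ} (hs0 : 0 < s)
    (hs1 : s < 1) (hp : 1 ≤ p) {ψ : E → ℝ} {L : ℝ≥0} (hL : LipschitzWith L ψ) {M : ℝ}
    (hM : ∀ x, |ψ x| ≤ M) :
    ∃ C : ℝ≥0∞, C ≠ ⊤ ∧ ∀ y,
      ∫⁻ x, ‖ψ x - ψ y‖ₑ ^ p / ‖x - y‖ₑ ^ ((Module.finrank ℝ E : ℝ) + s * p) ∂μ ≤ C := by
  set n : ℕ := Module.finrank ℝ E with hn_def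
  set N : ℝ := (n : ℝ) + s * p with hN
  have hp0 : 0 < p := by linarith
  have hnpos : (0 : ℝ) < n := by exact_mod_cast hn
  have hN0 : 0 < N := by positivity
  have hM0 : 0 ≤ M := (abs_nonneg _).trans (hM 0)
  -- the two real majorants
  set g₁ : E → ℝ := fun z => (L : ℝ) ^ p * ‖z‖ ^ (-(N - p)) with hg₁
  set g₂ : E → ℝ := fun z => (2 * M) ^ p * (2 : ℝ) ^ N * (1 + ‖z‖) ^ (-N) with hg₂
  have hg₁m : Measurable g₁ := measurable_const.mul (measurable_norm.pow_const _)
  have hg₂m : Measurable g₂ :=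
    measurable_const.mul ((measurable_const.add measurable_norm).pow_const _)
  -- their integrals are finite
  have hsp_lt : s * p < p := by
    have := mul_lt_mul_of_pos_right hs1 hp0
    rwa [one_mul] at this
  have hI₁ : ∫⁻ z in ball (0 : E) 1, ENNReal.ofReal (g₁ z) ∂μ < ⊤ := by
    have hint : IntegrableOn g₁ (ball (0 : E) 1) μ := by
      refine integrableOn_ball_of_norm_le_rpow hn (C := (L : ℝ) ^ p) (α := N - p) ?_ ?_
        hg₁m.aestronglyMeasurable
      · show N - p < (n : ℝ)
        rw [hN]; linarith
      · refine ae_of_all _ fun z => le_of_eq ?_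
        simp only [hg₁, Real.norm_eq_abs]
        exact abs_of_nonneg (by positivity)
    exact hint.lintegral_lt_top
  have hsp0 : 0 < s * p := mul_pos hs0 hp0
  have hI₂ : ∫⁻ z, ENNReal.ofReal (g₂ z) ∂μ < ⊤ := by
    have hc : 0 ≤ (2 * M) ^ p * (2 : ℝ) ^ N := by positivity
    have h1 : ∀ z, ENNReal.ofReal (g₂ z) =
        ENNReal.ofReal ((2 * M) ^ p * (2 : ℝ) ^ N) * ENNReal.ofReal ((1 + ‖z‖) ^ (-N)) := by
      intro z; simp only [hg₂]; rw [ENNReal.ofReal_mul hc]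
    simp_rw [h1]
    rw [lintegral_const_mul' _ _ ENNReal.ofReal_ne_top]
    exact ENNReal.mul_lt_top ENNReal.ofReal_lt_top
      (finite_integral_one_add_norm (by rw [hN]; linarith))
  refine ⟨(∫⁻ z in ball (0 : E) 1, ENNReal.ofReal (g₁ z) ∂μ) + ∫⁻ z, ENNReal.ofReal (g₂ z) ∂μ,
    (ENNReal.add_lt_top.2 ⟨hI₁, hI₂⟩).ne, fun y => ?_⟩
  -- translate to `z = x − y` and bound pointwise by the majorants
  have hpt : ∀ z : E, ‖ψ (y + z) - ψ y‖ₑ ^ p / ‖y + z - y‖ₑ ^ N ≤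
      (ball (0 : E) 1).indicator (fun z => ENNReal.ofReal (g₁ z)) z + ENNReal.ofReal (g₂ z) := by
    intro z
    rw [add_sub_cancel_left]
    have hδL : |ψ (y + z) - ψ y| ≤ L * ‖z‖ := by
      have h := hL.dist_le_mul (y + z) y
      rwa [Real.dist_eq, dist_eq_norm, add_sub_cancel_left] at h
    have hδM : |ψ (y + z) - ψ y| ≤ 2 * M := by
      calc |ψ (y + z) - ψ y| ≤ |ψ (y + z)| + |ψ y| := abs_sub _ _
        _ ≤ M + M := add_le_add (hM _) (hM _)
        _ = 2 * M := by ring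
    have hnum : ‖ψ (y + z) - ψ y‖ₑ ^ p = ENNReal.ofReal (|ψ (y + z) - ψ y| ^ p) := by
      rw [Real.enorm_eq_ofReal_abs, ENNReal.ofReal_rpow_of_nonneg (abs_nonneg _) hp0.le]
    have hden : ‖z‖ₑ ^ N = ENNReal.ofReal (‖z‖ ^ N) := by
      rw [← ofReal_norm, ENNReal.ofReal_rpow_of_nonneg (norm_nonneg _) hN0.le]
    rw [hnum, hden]
    by_cases hz1 : ‖z‖ < 1
    · -- near the diagonal
      refine le_add_right ?_
      rw [Set.indicator_of_mem (mem_ball_zero_iff.2 hz1)]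
      by_cases hz0 : z = 0
      · subst hz0
        simp [Real.zero_rpow hp0.ne']
      have hzpos : 0 < ‖z‖ := norm_pos_iff.2 hz0
      rw [← ENNReal.ofReal_div_of_pos (Real.rpow_pos_of_pos hzpos N)]
      refine ENNReal.ofReal_le_ofReal ?_
      rw [div_le_iff₀ (Real.rpow_pos_of_pos hzpos N)]
      calc |ψ (y + z) - ψ y| ^ p ≤ (L * ‖z‖) ^ p := Real.rpow_le_rpow (abs_nonneg _) hδL hp0.le
        _ = (L : ℝ) ^ p * ‖z‖ ^ (-(N - p)) * ‖z‖ ^ N := by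
            rw [Real.mul_rpow L.coe_nonneg (norm_nonneg _), mul_assoc, ← Real.rpow_add hzpos,
              show -(N - p) + N = p by ring]
        _ = g₁ z * ‖z‖ ^ N := by simp only [hg₁]
    · -- away from the diagonal
      rw [not_lt] at hz1
      refine le_add_left ?_
      have hzpos : 0 < ‖z‖ := lt_of_lt_of_le one_pos hz1
      rw [← ENNReal.ofReal_div_of_pos (Real.rpow_pos_of_pos hzpos N)]
      refine ENNReal.ofReal_le_ofReal ?_
      rw [div_le_iff₀ (Real.rpow_pos_of_pos hzpos N)]
      have h2M : |ψ (y + z) - ψ y| ^ p ≤ (2 * M) ^ p := Real.rpow_le_rpow (abs_nonneg _) hδM hp0.le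
      have hQ : (1 : ℝ) ≤ (2 : ℝ) ^ N * (1 + ‖z‖) ^ (-N) * ‖z‖ ^ N := by
        have h12 : 1 + ‖z‖ ≤ 2 * ‖z‖ := by linarith
        have hpos1 : 0 < 1 + ‖z‖ := by positivity
        have hpowpos : 0 < (1 + ‖z‖) ^ N := Real.rpow_pos_of_pos hpos1 N
        rw [Real.rpow_neg hpos1.le, mul_assoc, mul_comm ((1 + ‖z‖) ^ N)⁻¹, ← mul_assoc,
          ← Real.mul_rpow zero_le_two (norm_nonneg _), ← div_eq_mul_inv, one_le_div hpowpos]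
        exact Real.rpow_le_rpow hpos1.le h12 hN0.le
      calc |ψ (y + z) - ψ y| ^ p ≤ (2 * M) ^ p := h2M
        _ = (2 * M) ^ p * 1 := (mul_one _).symm
        _ ≤ (2 * M) ^ p * ((2 : ℝ) ^ N * (1 + ‖z‖) ^ (-N) * ‖z‖ ^ N) :=
            mul_le_mul_of_nonneg_left hQ (by positivity)
        _ = g₂ z * ‖z‖ ^ N := by simp only [hg₂]; ring
  calc ∫⁻ x, ‖ψ x - ψ y‖ₑ ^ p / ‖x - y‖ₑ ^ N ∂μ
      = ∫⁻ z, ‖ψ (y + z) - ψ y‖ₑ ^ p / ‖y + z - y‖ₑ ^ N ∂μ :=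
        (lintegral_add_left_eq_self (μ := μ) (fun x => ‖ψ x - ψ y‖ₑ ^ p / ‖x - y‖ₑ ^ N) y).symm
    _ ≤ ∫⁻ z, (ball (0 : E) 1).indicator (fun z => ENNReal.ofReal (g₁ z)) z + ENNReal.ofReal (g₂ z) ∂μ :=
        lintegral_mono hpt
    _ = _ := by
        rw [lintegral_add_left (hg₁m.ennreal_ofReal.indicator measurableSet_ball),
          lintegral_indicator measurableSet_ball]

end Weight

end DiNezzaPalatucciValdinoci2012

end Literature.Analysis.FunctionSpaces
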